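import Literature.AnabelianGeometry.SemiGraphs.TemperedAnabelian
import Literature.GroupTheory.CombinatorialGroupTheory.FreeGroupSubgroupSeparable

/-!
# [SemiAnbd] Lemma 6.3 (i) (Dense Subgroups) — proof of the named fact

Mochizuki, *Semi-graphs of anabelioids*, Publ. RIMS **42** (2006) 221–322, §6, Lemma 6.3 (i),
author's manuscript p. 70 [cite: MochizukiSemiAnbd2006, Lem 6.3(i) p.70]: "Let `F` be a finitely
generated free group of rank `> 1`. Suppose that `H ⊆ F` is a finitely generated subgroup which is
dense in `F̂`. Then `H = F`."  Proof-only companion (no definitions) of `TemperedAnabelian.lean`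
(p403906): it DISCHARGES the named fact `FreeGroupDenseFGSubgroupEqTop` exactly as typed there
(profinite completion = Mathlib's `ProfiniteGrp.ProfiniteCompletion.completion`).

Proof.  The print derives it from the structure of finitely generated subgroups of free groups
(Cor. 1.6 (ii), M. Hall); the tree already holds M. Hall's theorem in separable form,
`Literature.GroupTheory.CombinatorialGroupTheory.eq_top_of_fg_of_forall_sup_eq_top`: a finitely
generated subgroup with `H P = F` for every normal subgroup `P` of finite index is `F`.  Density of
the image of `H` in `F̂ = lim F/P` gives exactly that: the coordinate projection `F̂ → F/P` is
continuous onto a discrete group, so the dense set `image(H)` meets the open fibre over every coset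
`gP`, i.e. `gP = hP` for some `h ∈ H`.  (The rank hypothesis is not needed.)
-/

namespace Literature.AnabelianGeometry.SemiGraphs

open CategoryTheory ProfiniteGrp ProfiniteGrp.ProfiniteCompletion
open Literature.GroupTheory.CombinatorialGroupTheory

/-- [SemiAnbd] Lemma 6.3 (i) — DISCHARGED: a finitely generated subgroup of a finitely generated
free group whose image is dense in the profinite completion is the whole group.
[cite: MochizukiSemiAnbd2006, Lem 6.3(i) p.70] -/
theorem FreeGroupDenseFGSubgroupEqTop_holds : FreeGroupDenseFGSubgroupEqTop := by
  intro n _ H hH hdense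
  apply eq_top_of_fg_of_forall_sup_eq_top H hH
  intro P hPn hPf
  let m : FiniteIndexNormalSubgroup (FreeGroup (Fin n)) := FiniteIndexNormalSubgroup.ofSubgroup P
  rw [eq_top_iff]
  intro g _
  -- the coordinate projection of the completion at `P` is continuous onto a discrete group
  have hcont : Continuous fun x : completion (GrpCat.of (FreeGroup (Fin n))) => x.1 m :=
    (continuous_apply m).comp continuous_subtype_val
  haveI : DiscreteTopology ((diagram (GrpCat.of (FreeGroup (Fin n)))).obj m) := ⟨rfl⟩
  have hU : IsOpen {x : completion (GrpCat.of (FreeGroup (Fin n))) |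
      x.1 m = (QuotientGroup.mk g : FreeGroup (Fin n) ⧸ P)} :=
    (isOpen_discrete {y : (diagram (GrpCat.of (FreeGroup (Fin n)))).obj m |
      y = (QuotientGroup.mk g : FreeGroup (Fin n) ⧸ P)}).preimage hcont
  have hne : {x : completion (GrpCat.of (FreeGroup (Fin n))) |
      x.1 m = (QuotientGroup.mk g : FreeGroup (Fin n) ⧸ P)}.Nonempty :=
    ⟨toProfiniteCompletion (FreeGroup (Fin n)) g, rfl⟩
  obtain ⟨x, hxU, ⟨h, hh, rfl⟩⟩ := hdense.inter_open_nonempty _ hU hne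
  have hhg : (QuotientGroup.mk h : FreeGroup (Fin n) ⧸ P) = QuotientGroup.mk g := hxU
  rw [QuotientGroup.eq] at hhg
  rw [show g = h * (h⁻¹ * g) by group]
  exact Subgroup.mul_mem_sup hh hhg

end Literature.AnabelianGeometry.SemiGraphs
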